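import Summits.AtomisticToContinuum.HydrodynamicLimit.Theorems.DensityCap.Negative.Packing
import Summits.AtomisticToContinuum.HydrodynamicLimit.Theses.InformationPercolationEngine

/-!
# The UNGUARDED crux `DensityCap` inherits the implosion hazard: `DenseExcursionAbovePacking → ¬ DensityCap`

Negative-side structure for the crux `JParityClosure.DensityCap` (stmt-AtomisticToContinuum-13082), from the standing
disprover's `Cruxes/DensityCap/Disproof.lean` §8c–d (cycle 2), answering the r1 triage panel (TRIAGE-r1-2 §Finding),
on top of the sure packing bound, equal mass and the first-moment lemma of `Negative/Packing.lean`: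
* `packingBandAt_of_densityCap` — `DensityCap` AS FILED (no packing guard) PROVES a `σ`-uniform sup-norm packing band
  for EVERY tied classical hard-sphere-Euler solution at small `σ`: `ρ_t(x) σ³ ≤ 81/π` on `[0,T) × 𝕋³`
  (`PackingBandAt (81/π)` = the body of the rank-3 open-problem crux `DiluteSelfConsistency`, stmt-3091, at the fixed
  level `81/π` — a classification-strength PDE statement; its negation programme is `DenseExcursion`, stmt-12586).
  Proof: at an offending `(t, x₀)` continuity gives `ρ_t ≥ 81/(πσ³) + κ` on a minimal-image ball `B`; test the cap at
  `(t, η < κ vol B)`, `r ≤ 1/4`, `N` with `ε_N ≤ r`: EVERY good configuration overshoots (packing bound surely, masses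
  both `1`, first moment), an event of probability `1 > 1/2`;
* `densityCap_false_of_denseExcursionAbovePacking` — NEGATIVE LEMMA MODULO `H = DenseExcursionAbovePacking`
  (`PolynomialCompressionAt.Reaches (81/π < ρσ³)`): `H → ¬ DensityCap`. `H` is NOT constructible in the tree (a smooth
  implosion of the typed hard-sphere Euler system from low-density local Gibbs data; the object every `DenseExcursion`
  line is stalled on), so this is a HOLD, not a refutation;
* `densityCap_false_of_polynomialCompressionAt` — `PolynomialCompressionAt κ → ¬ DensityCap` for every `κ > 3`.
REPAIR (planner): add the packing guard `(∀ t ∈ Ico 0 T, ∀ x, ρ t x * σ ^ 3 < η₀)` under `∃ η₀ > 0` exactly as in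
`HydroLimitInBand` — the only form `ParityInBand` consumes; the guarded item is the grid upgrade of the band limit and
carries none of this hazard. refuter-cdisprove-stmt-AtomisticToContinuum-13082-g2-0.
-/

noncomputable section

namespace Summit.AtomisticToContinuum.HydrodynamicLimit.Theorems.DensityCapNegative

open MeasureTheory Filter Set Topology Metric
open scoped ENNReal
open Literature.MathematicalPhysics.KineticTheory Literature.Analysis.FluidPDE
open Literature.Analysis.FunctionSpaces
open Summit.AtomisticToContinuum.HydrodynamicLimit.Theses.JParityClosure
open Summit.AtomisticToContinuum.HydrodynamicLimit.Theorems.PolynomialCompressionPDE (Flows flows_nonempty)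
open Summit.AtomisticToContinuum.HydrodynamicLimit.Theorems.PolynomialCompressionAt (Reaches)

/-! ## §1 The unguarded crux proves a `σ`-uniform packing band for every tied classical solution -/

/-- The body of `DiluteSelfConsistency` at a FIXED packing level `C` (with `≤`): for all continuous positive profiles
there is `σ₀ > 0` such that for `0 < σ < σ₀` every classical hard-sphere-Euler solution tied at `t = 0` to the local
Gibbs data (through some flow family) satisfies `ρ_t(x) σ³ ≤ C` on `[0,T) × 𝕋³`. -/
def PackingBandAt (C : ℝ) : Prop :=
  ∀ (a₀ θ₀ : T3 → ℝ) (u₀ : T3 → V3), Continuous a₀ → Continuous θ₀ → Continuous u₀ →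
    (∀ x, 0 < a₀ x) → (∀ x, 0 < θ₀ x) → ∃ σ₀ : ℝ, 0 < σ₀ ∧ ∀ σ : ℝ, 0 < σ → σ < σ₀ →
    ∀ (T : ℝ) (ρ θ : ℝ → T3 → ℝ) (u : ℝ → T3 → V3), IsHardSphereEulerSolution σ T ρ u θ →
    ∀ Φ : Flows σ, TendstoHydroFieldsAt (fun N => localGibbsLaw σ a₀ u₀ θ₀ N (Φ N)) Φ ρ u θ 0 →
    ∀ t ∈ Ico 0 T, ∀ x, ρ t x * σ ^ 3 ≤ C

/-- Local Gibbs laws do not charge the complement of the good set of the flow (they are absolutely continuous with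
respect to the Liouville measure). -/
theorem ae_mem_good_localGibbsLaw (σ : ℝ) (a₀ θ₀ : T3 → ℝ) (u₀ : T3 → V3) (N : ℕ) (Φ : Flows σ) :
    ∀ᵐ z ∂(localGibbsLaw σ a₀ u₀ θ₀ N (Φ N)), z ∈ (Φ N).good := by
  have hL : localGibbsLaw σ a₀ u₀ θ₀ N (Φ N) =
      (liouville (Torus.geometry (Fin 3)) (N + 1) (hsDiameter σ N)).withDensity fun z => ENNReal.ofReal
        (canonicalDensity (Torus.geometry (Fin 3)) (hsDiameter σ N) (N + 1) (localGibbsProfile a₀ u₀ θ₀) z) := rfl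
  rw [hL]
  exact (withDensity_absolutelyContinuous _ _).ae_le (Φ N).ae_mem_good

/-- **`DensityCap` (unguarded) ⟹ the packing band `ρσ³ ≤ 81/π` for every tied classical solution at small `σ`.**
If a tied classical solution had `ρ_t(x₀) σ³ > 81/π`, then by continuity `ρ_t ≥ 81/(πσ³) + κ` on a minimal-image ball
`B` about `x₀`; test the cap at `(t, η)` with `η < κ vol B`, any admissible `r ≤ 1/4` and `N` so large that
`ε_N ≤ r`: for EVERY good configuration `z`, `w = Φ_N(t) z` lies in the hard-sphere domain, so `ρ̄ʳ(w) ≤ 81/(πσ³)`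
surely (`mollDensity_le_packing_hs`) while `∫ρ̄ʳ(w) = 1 = ∫ρ_t` (`integral_mollDensity_eq_one`, mass conservation +
tie), hence `ρ_t(x) + η < ρ̄ʳ(w)(x)` somewhere (`exists_overshoot_of_dense`): the overshoot event has probability
`1 > 1/2`. -/
theorem packingBandAt_of_densityCap (hDC : DensityCap) : PackingBandAt (81 / Real.pi) := by
  intro a₀ θ₀ u₀ ha hθ hu ha0 hθ0
  obtain ⟨σ₀, hσ₀, h⟩ := hDC a₀ θ₀ u₀ ha hθ hu ha0 hθ0
  refine ⟨min σ₀ (1 / 2), lt_min hσ₀ (by norm_num), ?_⟩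
  intro σ hσ hσlt T ρ θ u hE Φ hA t ht x₀
  have hσ0 : σ < σ₀ := lt_of_lt_of_le hσlt (min_le_left _ _)
  have hσ2 : σ < 1 / 2 := lt_of_lt_of_le hσlt (min_le_right _ _)
  by_contra hx
  push Not at hx
  have hpi := Real.pi_pos
  have hσ3 : 0 < σ ^ 3 := pow_pos hσ 3
  -- the Euler density exceeds the sure packing level `M` at `(t, x₀)` by `2κ`
  set M : ℝ := 81 / (Real.pi * σ ^ 3) with hMdef
  have hMlt : M < ρ t x₀ := by
    rw [hMdef, div_lt_iff₀ (by positivity)]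
    rw [div_lt_iff₀ hpi] at hx
    calc (81 : ℝ) < ρ t x₀ * σ ^ 3 * Real.pi := hx
      _ = ρ t x₀ * (Real.pi * σ ^ 3) := by ring
  set κ : ℝ := (ρ t x₀ - M) / 2 with hκdef
  have hκ : 0 < κ := by rw [hκdef]; linarith
  -- continuity: a minimal-image ball about `x₀` on which `ρ_t > M + κ`
  have hcont : Continuous (ρ t) := (hE.smooth_density.isSmooth_slice ht).continuous
  obtain ⟨b, hb, hb2, hball⟩ : ∃ b : ℝ, 0 < b ∧ b < 1 / 2 ∧ ∀ y, Torus.euclidDist y x₀ < b → M + κ ≤ ρ t y := by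
    have hlt : M + κ < ρ t x₀ := by rw [hκdef]; linarith
    have hev : ∀ᶠ y in 𝓝 x₀, M + κ < ρ t y := (hcont.tendsto x₀).eventually (lt_mem_nhds hlt)
    obtain ⟨b', hb', hball⟩ := Metric.eventually_nhds_iff.1 hev
    refine ⟨min b' (1 / 4), lt_min hb' (by norm_num), lt_of_le_of_lt (min_le_right _ _) (by norm_num),
      fun y hy => le_of_lt (hball ?_)⟩
    calc dist y x₀ = ‖y - x₀‖ := dist_eq_norm y x₀
      _ ≤ Torus.euclidDist y x₀ := Torus.norm_sub_le_euclidDist_holds y x₀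
      _ < b' := lt_of_lt_of_le hy (min_le_left _ _)
  set B : Set T3 := {y | Torus.euclidDist y x₀ < b} with hBdef
  have hBm : MeasurableSet B := measurableSet_euclidBall x₀ b
  have hBvol : 0 < (volume B).toReal := by
    rw [hBdef, volume_euclidBall hb hb2 x₀]
    refine ENNReal.toReal_pos (mul_ne_zero ?_ (measure_ball_pos volume _ one_pos).ne')
      (ENNReal.mul_ne_top ENNReal.ofReal_ne_top measure_ball_lt_top.ne)
    exact (ENNReal.ofReal_pos.2 (by positivity)).ne'
  -- test the cap at `(t, η, δ) = (t, κ vol B / 2, 1/2)`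
  set η : ℝ := κ * (volume B).toReal / 2 with hηdef
  have hη : 0 < η := by positivity
  have hηlt : η < κ * (volume B).toReal := by
    rw [hηdef]; linarith [mul_pos hκ hBvol]
  obtain ⟨r₀, hr₀, hr⟩ := h σ hσ hσ0 T ρ θ u hE Φ hA t ht η (1 / 2) hη (by norm_num)
  set r : ℝ := min (r₀ / 2) (1 / 4) with hrdef
  have hrpos : 0 < r := lt_min (by linarith) (by norm_num)
  have hrlt : r < r₀ := lt_of_le_of_lt (min_le_left _ _) (by linarith)
  have hr4 : r ≤ 1 / 4 := min_le_right _ _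
  obtain ⟨N₀, hN⟩ := hr r hrpos hrlt
  -- `N ≥ N₀` with `ε_N ≤ r`
  obtain ⟨N, hNN₀, hεN⟩ : ∃ N : ℕ, N₀ ≤ N ∧ hsDiameter σ N < r :=
    ((eventually_ge_atTop N₀).and
      ((tendsto_order.1 (Literature.Barriers.AtomisticToContinuum.hsDiameter_tendsto_zero σ)).2 r hrpos)).exists
  have hcap : localGibbsLaw σ a₀ u₀ θ₀ N (Φ N) (capEvent Φ N ρ t η r) ≤ ENNReal.ofReal (1 / 2) := hN N hNN₀
  haveI : IsProbabilityMeasure (localGibbsLaw σ a₀ u₀ θ₀ N (Φ N)) :=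
    isProbabilityMeasure_localGibbsLaw ha hθ hu ha0 hθ0 hσ2.le N (Φ N)
  -- mass of the Euler density at time `t`
  have hmass : ∫ x, ρ t x = 1 := by
    rw [DenseExcursionEverywhere.integral_density_eq hE ht]
    exact DenseExcursionEverywhere.integral_density_zero_eq_one hσ2.le ha hθ hu ha0 hθ0 Φ hA
  have hρint : Integrable (ρ t) volume := integrable_of_continuous_T3 hcont
  -- every good configuration overshoots
  have hsubset : (Φ N).good ⊆ capEvent Φ N ρ t η r := by
    intro z hz
    have hw : (Φ N).flow t z ∈ hardSphereDomain (Torus.geometry (Fin 3)) (N + 1) (hsDiameter σ N) :=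
      (Φ N).good_subset ((Φ N).mapsTo_good t hz)
    refine ⟨t, ⟨ht.1, le_rfl⟩, ?_⟩
    exact exists_overshoot_of_dense (f := fun x => mollDensity r ((Φ N).flow t z) x) (g := ρ t)
      (integrable_mollDensity hrpos _) hρint hBm
      (fun x => mollDensity_le_packing_hs hσ hεN.le hr4 hw x) (fun y hy => hball y hy)
      (le_of_eq (by rw [hmass, integral_mollDensity_eq_one hrpos (by linarith) (Nat.succ_ne_zero N)]))
      hη.le hηlt
  have hone : localGibbsLaw σ a₀ u₀ θ₀ N (Φ N) (Φ N).good = 1 := by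
    rw [← prob_compl_eq_zero_iff (Φ N).measurableSet_good]
    exact ae_iff.1 (ae_mem_good_localGibbsLaw σ a₀ θ₀ u₀ N Φ)
  have hge : (1 : ℝ≥0∞) ≤ ENNReal.ofReal (1 / 2) := by
    calc (1 : ℝ≥0∞) = localGibbsLaw σ a₀ u₀ θ₀ N (Φ N) (Φ N).good := hone.symm
      _ ≤ localGibbsLaw σ a₀ u₀ θ₀ N (Φ N) (capEvent Φ N ρ t η r) := measure_mono hsubset
      _ ≤ ENNReal.ofReal (1 / 2) := hcap
  exact absurd (lt_of_le_of_lt hge (ENNReal.ofReal_lt_one.2 (by norm_num))) (lt_irrefl 1)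

/-! ## §2 Negative lemma modulo a dense excursion above the packing level -/

/-- `H`: A DENSE EXCURSION ABOVE THE SURE PACKING LEVEL — some continuous positive profiles admit, for every `σ₀ > 0`,
a reduced density `σ < σ₀` and a classical hard-sphere-Euler solution on some `[0,T)`, tied at `t = 0` to the local
Gibbs data through every flow family, whose reduced density exceeds `81/π` at some `(t, x)`, `t < T`
(`PolynomialCompressionAt.Reaches (81/π < ρσ³)`; the crux `DenseExcursion` at the level `81/π`, strict). NOT
CONSTRUCTIBLE in the tree: it needs a smooth implosion of the typed hard-sphere Euler system from low-density local
Gibbs data (MerleEtAl2022 / CaolaboraEtAl2025-type profiles forced through the hard-sphere equation of state), the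
object every `DenseExcursion`/`PolynomialCompression` line is stalled on (implosion profiles in print: MerleEtAl2022,
BuckmasterCaolaboraGomezserrano2025, CaolaboraEtAl2025 — polytropic / ideal gases, NOT the hard-sphere pressure law,
and not tied local Gibbs data; this `def` is a HYPOTHESIS of the negative lemma below, not a vendored fact). -/
def DenseExcursionAbovePacking : Prop :=
  Reaches fun σ r => 81 / Real.pi < r * σ ^ 3

/-- `H` is EXACTLY the failure of the packing band at level `81/π`: `DenseExcursionAbovePacking ↔ ¬ PackingBandAt (81/π)`
(a flow family exists for `σ < 1/2`, Alexander; the `t = 0` tie through one flow family gives it through all,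
`PolynomialCompressionAt.tendstoHydroFieldsAt_zero_of_one_flow`). So the hold reads: the unguarded crux is TRUE only
if `DiluteSelfConsistency` holds at level `81/π`, and FALSE otherwise. -/
theorem denseExcursionAbovePacking_iff_not_packingBandAt :
    DenseExcursionAbovePacking ↔ ¬ PackingBandAt (81 / Real.pi) := by
  constructor
  · rintro ⟨a₀, θ₀, u₀, ha, hθ, hu, ha0, hθ0, H⟩ hband
    obtain ⟨σ₀, hσ₀, hband⟩ := hband a₀ θ₀ u₀ ha hθ hu ha0 hθ0
    obtain ⟨σ, hσ, hσlt, T, ρ, θ, u, hE, hA, t, ht, x, hx⟩ := H (min σ₀ (1 / 2)) (lt_min hσ₀ (by norm_num))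
    have hσ0 : σ < σ₀ := lt_of_lt_of_le hσlt (min_le_left _ _)
    have hσ2 : σ < 1 / 2 := lt_of_lt_of_le hσlt (min_le_right _ _)
    obtain ⟨Φ⟩ := flows_nonempty hσ hσ2
    have hle := hband σ hσ hσ0 T ρ θ u hE Φ (hA Φ) t ht x
    exact absurd hx (not_lt.2 hle)
  · intro h
    unfold PackingBandAt at h
    push Not at h
    obtain ⟨a₀, θ₀, u₀, ha, hθ, hu, ha0, hθ0, H⟩ := h
    refine ⟨a₀, θ₀, u₀, ha, hθ, hu, ha0, hθ0, fun σ₀ hσ₀ => ?_⟩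
    obtain ⟨σ, hσ, hσlt, T, ρ, θ, u, hE, Φ, hA, t, ht, x, hx⟩ := H σ₀ hσ₀
    exact ⟨σ, hσ, hσlt, T, ρ, θ, u, hE,
      fun Ψ => PolynomialCompressionAt.tendstoHydroFieldsAt_zero_of_one_flow Φ Ψ hA, t, ht, x, hx⟩

/-- **NEGATIVE LEMMA MODULO `DenseExcursionAbovePacking`: `H → ¬ DensityCap`.** The unguarded crux proves the
packing band `ρσ³ ≤ 81/π` for every tied classical solution at small `σ` (`packingBandAt_of_densityCap`), which `H`
denies. -/
theorem densityCap_false_of_denseExcursionAbovePacking (hH : DenseExcursionAbovePacking) : ¬ DensityCap :=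
  fun hDC => denseExcursionAbovePacking_iff_not_packingBandAt.1 hH (packingBandAt_of_densityCap hDC)

/-- Contrapositive packaging for planners: the unguarded crux FAILS as soon as the packing band at level `81/π` fails
for some profiles (no appeal to `H`'s `∀ Φ` form). -/
theorem not_densityCap_of_not_packingBandAt (h : ¬ PackingBandAt (81 / Real.pi)) : ¬ DensityCap :=
  fun hDC => h (packingBandAt_of_densityCap hDC)

/-- **`PolynomialCompressionAt κ → ¬ DensityCap` for every `κ > 3`**: a tied classical solution reaching density
`σ^(-κ)` has reduced density `σ^(3-κ) > 81/π` once `σ` is small. -/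
theorem densityCap_false_of_polynomialCompressionAt {κ : ℝ} (hκ : 3 < κ) (hPC : PolynomialCompressionAt κ) :
    ¬ DensityCap := by
  refine densityCap_false_of_denseExcursionAbovePacking ?_
  have hpi := Real.pi_pos
  -- threshold: `σ^(κ-3) < π/81` as soon as `σ < σ₁ := (π/81)^(1/(κ-3))`
  set σ₁ : ℝ := (Real.pi / 81) ^ (1 / (κ - 3)) with hσ₁def
  have hσ₁ : 0 < σ₁ := Real.rpow_pos_of_pos (by positivity) _
  refine PolynomialCompressionAt.Reaches.mono hσ₁ (fun σ r hσ hσlt hr => ?_) ((PolynomialCompressionAt.iff_reaches κ).1 hPC)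
  have hk3 : 0 < κ - 3 := by linarith
  have hpow : σ ^ (κ - 3) < Real.pi / 81 := by
    calc σ ^ (κ - 3) < σ₁ ^ (κ - 3) := Real.rpow_lt_rpow hσ.le hσlt hk3
      _ = Real.pi / 81 := by
          rw [hσ₁def, ← Real.rpow_mul (by positivity), one_div_mul_cancel hk3.ne', Real.rpow_one]
  have hkey : σ ^ (-κ) * σ ^ (3 : ℕ) = (σ ^ (κ - 3))⁻¹ := by
    rw [← Real.rpow_natCast, ← Real.rpow_add hσ, ← Real.rpow_neg hσ.le]
    congr 1
    push_cast
    ring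
  show 81 / Real.pi < r * σ ^ 3
  calc 81 / Real.pi < (σ ^ (κ - 3))⁻¹ := by
        rw [lt_inv_comm₀ (by positivity) (Real.rpow_pos_of_pos hσ _), inv_div]
        exact hpow
    _ = σ ^ (-κ) * σ ^ (3 : ℕ) := hkey.symm
    _ ≤ r * σ ^ 3 := mul_le_mul_of_nonneg_right hr (pow_nonneg hσ.le 3)

/-- The same statement is wanted (as support, rank 9) by route InformationPercolationEngine, whose route file states it
VERBATIM: the two decls are definitionally equal, so every negative result transports. -/
theorem informationPercolationEngine_densityCap_iff :
    Summit.AtomisticToContinuum.HydrodynamicLimit.Theses.InformationPercolationEngine.DensityCap ↔ DensityCap :=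
  Iff.rfl

/-- The hold transported to the InformationPercolationEngine copy: `H → ¬ InformationPercolationEngine.DensityCap`. -/
theorem ipeDensityCap_false_of_denseExcursionAbovePacking (hH : DenseExcursionAbovePacking) :
    ¬ Summit.AtomisticToContinuum.HydrodynamicLimit.Theses.InformationPercolationEngine.DensityCap :=
  densityCap_false_of_denseExcursionAbovePacking hH

end Summit.AtomisticToContinuum.HydrodynamicLimit.Theorems.DensityCapNegative

end
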